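import Summits.Ventures.PercRepro.SingleMergeSeven
import Summits.Ventures.PercRepro.CodeBoundEight
import Summits.Ventures.PercRepro.LineC

/-!
# C-005 for every marked multigraph with at most seven edges

Every face map of a marked multigraph is a single-merge map (typer-2 `singleMergeMap_class`) on
the face's free edges, a subtype of the edge set; with at most seven edges every face has at most
seven coordinates, so `crossCount_le_topBotCount_of_card_le_seven` (the dimension lemma + the
column lemma) makes every face term of the two-copy expansion of `N(c, c)` nonnegative
(`nestedForm_self_eq_sum_faces`, `sum_crossKernel_compl`), and `nestedForm_markedPartition`
turns `N(c, c) ≥ 0` into the C-005 inequality. No computation: the bound is a theorem for every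
graph, every marking and every weight vector with `|E| ≤ 7`. Given the 8-point code bound
`CodeBound8` (a finite set-system statement, kissat-certified for `Fin 8`), the same argument with
`crossCount_le_topBotCount_of_card_le_eight` extends the scope to `|E| ≤ 8`
(`C005_of_card_le_eight`).
-/

namespace PercRepro

open Finset

/-- **C-005 for every marked multigraph with at most seven edges**, at every weight vector. -/
theorem C005_of_card_le_seven {V E : Type} [Fintype E] [DecidableEq E] (G : MultiGraph V E)
    (hE : Fintype.card E ≤ 7) (p : E → ℝ) (hp : IsProb p) (a b c d : V) :
    prob p (G.partitionEvent ![a, b, c, d] ![0, 0, 1, 1]) *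
        prob p (G.partitionEvent ![a, b, c, d] ![0, 1, 0, 1]) +
      prob p (G.partitionEvent ![a, b, c, d] ![0, 0, 1, 1]) *
        prob p (G.partitionEvent ![a, b, c, d] ![0, 1, 1, 0]) +
      prob p (G.partitionEvent ![a, b, c, d] ![0, 1, 0, 1]) *
        prob p (G.partitionEvent ![a, b, c, d] ![0, 1, 1, 0]) ≤
    prob p (G.partitionEvent ![a, b, c, d] ![0, 0, 0, 0]) *
      prob p (G.partitionEvent ![a, b, c, d] ![0, 1, 2, 3]) := by
  classical
  have key : 0 ≤ nestedForm p (fun ω => G.markedPartition ω ![a, b, c, d])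
      (fun ω => G.markedPartition ω ![a, b, c, d]) := by
    rw [nestedForm_self_eq_sum_faces]
    refine Finset.sum_nonneg fun uv _ => ?_
    refine mul_nonneg (mul_nonneg (weight_nonneg hp _) (weight_nonneg hp _)) ?_
    split_ifs with hle
    · set cf : Config (Face uv.1 uv.2) → Setoid (Fin 4) :=
        fun ρ => G.markedPartition (embed uv.1 uv.2 ρ) ![a, b, c, d] with hcf
      have hsm : SingleMergeMap cf := G.singleMergeMap_class ![a, b, c, d] uv.1 uv.2
      have hmono : Monotone cf :=
        (G.monotone_markedPartition_four ![a, b, c, d]).comp (embed_mono uv.1 uv.2)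
      have hcard : Fintype.card (Face uv.1 uv.2) ≤ 7 :=
        (Fintype.card_le_of_injective Subtype.val Subtype.val_injective).trans hE
      have hB := crossCount_le_topBotCount_of_card_le_seven cf hmono hsm hcard
      have h' : (crossCount cross4 cf : ℝ) ≤ topBotCount cf := by exact_mod_cast hB
      have hsum := sum_crossKernel_compl cross4_injective cf
      rw [show (∑ ρ : Config (Face uv.1 uv.2), nestedKernel (cf ρ) (cf ρᶜ)) =
        ∑ ρ : Config (Face uv.1 uv.2), crossKernel cross4 (cf ρ) (cf ρᶜ) from rfl, hsum]
      linarith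
    · exact le_rfl
  rw [G.nestedForm_markedPartition] at key
  linarith

/-- **C-005 for every marked multigraph with at most eight edges**, given the 8-point code bound. -/
theorem C005_of_card_le_eight (hcode : CodeBound8) {V E : Type} [Fintype E] [DecidableEq E]
    (G : MultiGraph V E) (hE : Fintype.card E ≤ 8) (p : E → ℝ) (hp : IsProb p) (a b c d : V) :
    prob p (G.partitionEvent ![a, b, c, d] ![0, 0, 1, 1]) *
        prob p (G.partitionEvent ![a, b, c, d] ![0, 1, 0, 1]) +
      prob p (G.partitionEvent ![a, b, c, d] ![0, 0, 1, 1]) *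
        prob p (G.partitionEvent ![a, b, c, d] ![0, 1, 1, 0]) +
      prob p (G.partitionEvent ![a, b, c, d] ![0, 1, 0, 1]) *
        prob p (G.partitionEvent ![a, b, c, d] ![0, 1, 1, 0]) ≤
    prob p (G.partitionEvent ![a, b, c, d] ![0, 0, 0, 0]) *
      prob p (G.partitionEvent ![a, b, c, d] ![0, 1, 2, 3]) := by
  classical
  have key : 0 ≤ nestedForm p (fun ω => G.markedPartition ω ![a, b, c, d])
      (fun ω => G.markedPartition ω ![a, b, c, d]) := by
    rw [nestedForm_self_eq_sum_faces]
    refine Finset.sum_nonneg fun uv _ => ?_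
    refine mul_nonneg (mul_nonneg (weight_nonneg hp _) (weight_nonneg hp _)) ?_
    split_ifs with hle
    · set cf : Config (Face uv.1 uv.2) → Setoid (Fin 4) :=
        fun ρ => G.markedPartition (embed uv.1 uv.2 ρ) ![a, b, c, d] with hcf
      have hsm : SingleMergeMap cf := G.singleMergeMap_class ![a, b, c, d] uv.1 uv.2
      have hmono : Monotone cf :=
        (G.monotone_markedPartition_four ![a, b, c, d]).comp (embed_mono uv.1 uv.2)
      have hcard : Fintype.card (Face uv.1 uv.2) ≤ 8 :=
        (Fintype.card_le_of_injective Subtype.val Subtype.val_injective).trans hE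
      have hB := crossCount_le_topBotCount_of_card_le_eight hcode cf hmono hsm hcard
      have h' : (crossCount cross4 cf : ℝ) ≤ topBotCount cf := by exact_mod_cast hB
      have hsum := sum_crossKernel_compl cross4_injective cf
      rw [show (∑ ρ : Config (Face uv.1 uv.2), nestedKernel (cf ρ) (cf ρᶜ)) =
        ∑ ρ : Config (Face uv.1 uv.2), crossKernel cross4 (cf ρ) (cf ρᶜ) from rfl, hsum]
      linarith
    · exact le_rfl
  rw [G.nestedForm_markedPartition] at key
  linarith

end PercRepro
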